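import Summits.SmoothPoincare4.SmoothPoincare4.Theses.CongruenceShadows
import Summits.SmoothPoincare4.SmoothPoincare4.Theorems.WaldhausenPairs.Negative.LoadBearing
import Summits.SmoothPoincare4.SmoothPoincare4.Theorems.WaldhausenPairs.Negative.PairTransferFalse
import Literature.Topology.FourManifolds.TrisectionFunctorGK
import Literature.Topology.FourManifolds.SphereTrisections
import Literature.Topology.FourManifolds.TrisectionCentralSurfaceMarking
import Literature.Topology.FourManifolds.FreeFundamentalGroupThreeManifold
import Literature.Topology.FourManifolds.OneHandlebodyMirrorFour
import Literature.AlgebraicTopology.FundamentalGroup.VanKampenEpi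

/-!
# Line `agk-realization-device` — skeleton for crux `CongruenceShadows.WaldhausenPairs`
(item stmt-SmoothPoincare4-14592; idea card `Cruxes/WaldhausenPairs/Ideas/agk-realization-device.md`;
triage TRIAGE-r1-1/2/3: pass ×3)

Crux (FIXED, the route decl, never restated):
`∀ m K, IsGroupTrisection (3+3m) (m+1) PUnit K → ∀ i ≠ j, ∃ α ∈ Aut S_{3+3m}, α(N_i) = K_i ∧ α(N_j) = K_j`,
`N = s4Kernels.stabilizeIter m`.

## The line (cluster E of the triage, in its cheapest form)

REALISE, then WALDHAUSEN on the sector boundary, with ZERO new Literature facts: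

1. (STUB 1 = fact (e'), Abrams–Gay–Kirby Thm 5, the map `ℳ`) realise BOTH the given triple `K`
   and the standard triple `N` (a group trisection of `{1}` by the landed
   `Negative.LoadBearing.stabilizeIter_isGroupTrisection`) as kernel triples
   `groupGKTrisectionOf` of balanced `(3+3m, m+1)` Gay–Kirby trisections of closed oriented smooth
   4-manifolds `X`, `X'`, re-marked to EQUALITY (`exists_marking_groupGKTrisectionOf_eq`, proved).
   No `S⁴`, no (c')/(d') is needed (improvement on the card: the standard side is realised by the
   same device).
2. (STUB 5, `stub_pairRealization`, the LOAD-BEARING geometric stub) the `(i,j)` kernel pair of a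
   balanced GK trisection is the kernel pair of a genus-`g` Heegaard splitting `Y = H₁ ∪_f H₂` of a
   closed connected smooth 3-manifold `Y` with `π₁ Y` free of rank `k`: `H₁`, `H₂` are the
   clause-(iii) handlebodies `S(i+1) ∩ S(i+2)`, `S(j+1) ∩ S(j+2)`, `f = h₂⁻¹ ∘ h₁` on the central
   surface, `Y` is glued ABSTRACTLY (`exists_isBoundaryGluing_holds`) and is HOMEOMORPHIC (not
   claimed diffeomorphic — this is how the corner of `cornerUnbend`, triage r1-1/3, is avoided) to
   `∂X_l = H₁ ∪ H₂ ⊂ X`, whose `π₁` is free of rank `k` by the PROVED (T3)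
   `IsGKTrisection.isFreeOfRank_fundamentalGroup_sectorBoundary`.
3. The clause-(iii) handlebodies of a GK trisection of an ORIENTED 4-manifold are orientable, so
   they are `IsHandlebody g` — PROVED in the tree (`IsGKTrisection.isOrientable_of_clause_iii`,
   `TrisectionCentralSurfaceMarking.lean`; found by `lean search`, so it is NOT a stub); (STUB 4,
   `stub_gluedOrientable`) a boundary gluing of two orientable 3-manifolds along a connected
   surface is orientable (so `Y` is orientable).
4. (STUBS 2, 3 = the two facts filed FOR this item, Waldhausen 1968 `wi-25606` and
   Kneser–Stallings–Perelman `wi-25611`) through the PROVED composite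
   `heegaardSplittings_diffeomorphic_of_isFreeOfRank`, on the PROVED model 1-handlebody
   `exists_oneHandlebody_mirror_four (m+1)`: the two splittings are diffeomorphic as triples.
5. (STUB 6, `stub_kernelTransport`) a homeomorphism of triads `(Y'; A', B') → (Y; A, B)` transports
   the kernel pair of `π₁(A' ∩ B') → π₁ A', π₁ B'` onto that of `(Y; A, B)` through any markings:
   ONE `α` for both kernels (honours `Negative.PairTransferFalse.not_pairTransfer`).

`WaldhausenPairs_from : STUB1 → STUB2 → STUB3 → STUB4 → STUB5 → STUB6 → id WaldhausenPairs`
is proved below WITHOUT sorry (axioms: the gate whitelist only); the skeleton theorem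
`WaldhausenPairs_of : WaldhausenPairs` feeds it the six sorried stubs (so the stub statements are
checked to be literally its hypotheses, and `sorry` occurs only inside `stub_*`).

## Disproof.lean / Negative lemmas honoured (imported above)

* `Negative.LoadBearing.waldhausenPairs_false_without_pairFree` / `_false_without_freeQuotient`
  (§A): the WHOLE `IsGroupTrisection` record is consumed, at the single step
  `he (3+3m) (m+1) PUnit K hK` (STUB 1's input type is verbatim the crux hypothesis).
* `Negative.PairTransferFalse.not_pairTransfer` (§B): `α` is read off ONE homeomorphism of triads
  (STUB 6 returns one `α` with both equations); no single-kernel standardisation is chained.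
  `not_rigid` / `IsGroupTrisection.map_mulEquiv` (§B'): nothing here pretends the hypothesis pins
  `K_j` from `K_i`.
* §C (`HeegaardPairOrbit`): this line uses the third kernel only to EXIST (input of `ℳ`); §D
  (`TripleStandard`) is not touched. Crux NOTES §1 (PC3-hardness): the Perelman-bearing
  declarations consumed are STUB 1 (e') and STUB 3 (KSP) — by name twice, in substance once
  ((e')'s printed proof, AGK p. 1542, itself uses Kneser–Stallings–Perelman).
* No stub is an instance of a landed Negative lemma: STUBS 4–6 are statements about manifolds /
  homeomorphisms, STUBS 1–3 are the vendored named facts verbatim.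
-/

noncomputable section

set_option linter.dupNamespace false
set_option linter.unusedVariables false

open scoped Manifold ContDiff Topology
open Set Function Literature.Topology.FourManifolds
open Literature.AlgebraicTopology.FundamentalGroup.VanKampen (inclHomOfSubset)
open Summit.SmoothPoincare4.SmoothPoincare4.Theses.CongruenceShadows (WaldhausenPairs)

namespace Summit.SmoothPoincare4.SmoothPoincare4.Cruxes.WaldhausenPairs.AgkRealizationDevice

/-! ## Fact stubs (vendored named facts, consumed by name; debt, not work for the lead) -/

/-- **STUB 1 — FACT (e'), Abrams–Gay–Kirby 2018 Thm 5, the map `ℳ` (XL; Perelman inside; the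
line's declared fact debt, shared with nothing else on the route).**  Every `(g,k)` group
trisection of `G` is, up to isomorphism of kernel triples, the kernel triple of a balanced
Gay–Kirby trisection of a closed connected oriented smooth 4-manifold.  Verbatim the tree's named
fact `Literature.Topology.FourManifolds.exists_gkTrisected_of_isGroupTrisection` at universe `0`
(the crux quantifies over `PUnit : Type`).  Consumed twice: for `K` and for the standard `N`.
[cite: AbramsGayKirby2018, Thm. 5 (p. 1541)] -/
theorem stub_agkRealization : exists_gkTrisected_of_isGroupTrisection.{0} := by
  sorry

/-- **STUB 2 — FACT, Waldhausen 1968 (Heegaard splittings of `#ᵏ S¹×S²` are unique; L/XL;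
Perelman-free; cite item `wi-25606` filed FOR this crux).**  Verbatim the tree's named fact
`Literature.Topology.FourManifolds.waldhausen_heegaardSplitting_sumS1S2_unique` (ordered
diffeomorphism-of-triples form) at universe `0`. [cite: MeierSchirmerZupan2016, Thm. 2.7]
[cite: Waldhausen1968, pp. 195–203] -/
theorem stub_waldhausen : waldhausen_heegaardSplitting_sumS1S2_unique.{0} := by
  sorry

/-- **STUB 3 — FACT, Kneser–Stallings + Perelman (a closed orientable 3-manifold with `π₁` free of
rank `k` is `#ᵏ S¹×S²`; XL; Perelman inside; cite item `wi-25611` filed FOR this crux).**  Verbatim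
the tree's named fact
`Literature.Topology.FourManifolds.diffeomorph_sumS1S2_of_isFreeOfRank_fundamentalGroup` at
universe `0`.  It is what lets the line skip the corner-smoothing of the sector boundary: the
glued `Y` need only be HOMEOMORPHIC to `∂X_l` (for its `π₁`), never diffeomorphic to
`bW.carrier`. [cite: AbramsGayKirby2018, p. 4 (proof of Thm. 5)] [cite: Hempel1976, Thm. 5.2, 5.3, 7.1] -/
theorem stub_freePiOneRecognition : diffeomorph_sumS1S2_of_isFreeOfRank_fundamentalGroup.{0} := by
  sorry

/-! ## Geometric stubs -/

/-- **STUB 4 — a boundary gluing of two orientable 3-manifolds along a connected surface is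
orientable (M).**  If `Y = H₁ ∪_f H₂` (`IsBoundaryGluingWith b₁ b₂ f (𝓡 3) j₁ j₂`) with `H₁`, `H₂`
orientable and the seam `b₁.carrier` connected, then `Y` is orientable: orient `H₁`; the boundary
orientation of `b₁.carrier` is carried by `f` either to the boundary orientation of `H₂` or to its
negative (connected seam, `SmoothOrientation.eq_or_eq_neg_of_connectedSpace`); replacing the
orientation of `H₂` by its negative if necessary, the push-forwards along the immersions `j₁`, `j₂`
(local diffeomorphisms `3 → 3` up to the boundary) agree on the seam because `j₁(H₁)` and `j₂(H₂)`
lie on opposite sides of it (they meet only along the seam and cover `Y`), and define a smooth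
orientation of `Y`.  Hirsch, *Differential Topology*, §4.4 and §8.2. [cite: HirschDT1976, §8.2] -/
theorem stub_gluedOrientable :
    ∀ (H₁ : Type) [TopologicalSpace H₁] [ChartedSpace (EuclideanHalfSpace 3) H₁]
      [IsManifold (𝓡∂ 3) ∞ H₁]
      (H₂ : Type) [TopologicalSpace H₂] [ChartedSpace (EuclideanHalfSpace 3) H₂]
      [IsManifold (𝓡∂ 3) ∞ H₂]
      (b₁ : BoundaryData (𝓡∂ 3) H₁ (𝓡 2)) (b₂ : BoundaryData (𝓡∂ 3) H₂ (𝓡 2))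
      (f : b₁.carrier ≃ₘ⟮𝓡 2, 𝓡 2⟯ b₂.carrier)
      (Y : Type) [TopologicalSpace Y] [ChartedSpace (EuclideanSpace ℝ (Fin 3)) Y]
      [IsManifold (𝓡 3) ∞ Y] (j₁ : H₁ → Y) (j₂ : H₂ → Y),
      IsOrientable (𝓡∂ 3) H₁ → IsOrientable (𝓡∂ 3) H₂ → ConnectedSpace b₁.carrier →
      IsBoundaryGluingWith b₁ b₂ f (𝓡 3) j₁ j₂ → IsOrientable (𝓡 3) Y := by
  sorry

/-- **STUB 5 — PAIR REALISATION on the sector boundary (L; the load-bearing stub of the line).**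
For a balanced `(g,k)` Gay–Kirby trisection `S` of a smooth 4-manifold `X`, a marking `μ` of the
central surface `F` at `x₀`, and `i ≠ j`: there are a closed (compact, Hausdorff, second countable,
boundaryless charts) connected smooth 3-manifold `Y` with `π₁(Y)` FREE OF RANK `k`, compact
connected 3-manifolds with boundary `H₁`, `H₂` with one `0`-handle and `g` `1`-handles, smoothly
embedded in `X` by `h₁`, `h₂` onto `S(i+1) ∩ S(i+2)` and `S(j+1) ∩ S(j+2)` with `hᵣ(∂Hᵣ) = F`
(witnesses of clause (iii), exposed so that the tree's PROVED
`IsGKTrisection.isOrientable_of_clause_iii` makes them `IsHandlebody g` in the composition), a diffeomorphism `f : ∂H₁ ≅ ∂H₂`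
(namely `h₂⁻¹ ∘ h₁` on boundary data: two smooth embeddings of closed surfaces with the same image
`F` differ by a diffeomorphism), a gluing `Y = H₁ ∪_f H₂` (`exists_isBoundaryGluing_holds`) with
pieces `j₁`, `j₂`, connected seam, and a marking `ν` of the Heegaard surface
`Σ = j₁(H₁) ∩ j₂(H₂) ⊂ Y` at a point `s`, such that the kernel pair
`(ker π₁Σ → π₁ j₁(H₁), ker π₁Σ → π₁ j₂(H₂))` pulled back by `ν` IS the `(i,j)` pair of
`groupGKTrisectionOf hS x₀ μ`.  Proof route: the map `Θ : Y → X`, `Θ ∘ j₁ = h₁`, `Θ ∘ j₂ = h₂`, is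
well defined by the seam relation, continuous, injective (the two handlebodies meet in `F`), hence
a homeomorphism of the compact `Y` onto `∂X_l = S l ∩ (S(l+1) ∪ S(l+2))` (`l ∉ {i,j}`) carrying
`Σ`, `j₁(H₁)`, `j₂(H₂)` onto `F`, `S(i+1) ∩ S(i+2)`, `S(j+1) ∩ S(j+2)`; `π₁(∂X_l)` is free of rank
`k` by the PROVED (T3) `IsGKTrisection.isFreeOfRank_fundamentalGroup_sectorBoundary`; the kernels
are transported along `Θ` (`fundamentalGroupEquivOfHomeomorph`, `InclHomTransport.lean`), with
`s = Θ⁻¹ x₀`, `ν = Θ_*⁻¹ ∘ μ`.  No smooth comparison of `Y` with `bW.carrier` is claimed (triage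
r1-1 corner computation honoured).  Why it might fail: only by a typing slip — every ingredient is
Gay–Kirby Def. 1 read through `IsGKTrisection` clauses (ii)–(iii); the seam-diffeomorphism lemma
("equal images ⇒ differ by a diffeomorphism") may have to be proved
(cf. `BoundaryData.nonempty_diffeomorph_holds`). [cite: GayKirby2016, Def. 1]
[cite: AbramsGayKirby2018, p. 1540 (the map 𝒢)] -/
theorem stub_pairRealization :
    ∀ (X : Type) [TopologicalSpace X] [T2Space X] [SecondCountableTopology X]
      [ChartedSpace (EuclideanSpace ℝ (Fin 4)) X] [IsManifold (𝓡 4) ∞ X]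
      (g k : ℕ) (S : Fin 3 → Set X) (hS : IsBalancedGKTrisection X g k S)
      (x₀ : centralSurface S) (μ : SurfaceGroup g ≃* FundamentalGroup (centralSurface S) x₀)
      (i j : Fin 3), i ≠ j →
      ∃ (Y : Type) (_ : TopologicalSpace Y) (_ : T2Space Y) (_ : SecondCountableTopology Y)
        (_ : ChartedSpace (EuclideanSpace ℝ (Fin 3)) Y) (_ : IsManifold (𝓡 3) ∞ Y)
        (_ : CompactSpace Y) (_ : ConnectedSpace Y) (y : Y)
        (_ : IsFreeOfRank (FundamentalGroup Y y) k)
        (H₁ : Type) (_ : TopologicalSpace H₁) (_ : ChartedSpace (EuclideanHalfSpace 3) H₁)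
        (_ : IsManifold (𝓡∂ 3) ∞ H₁) (_ : CompactSpace H₁) (_ : ConnectedSpace H₁)
        (H₂ : Type) (_ : TopologicalSpace H₂) (_ : ChartedSpace (EuclideanHalfSpace 3) H₂)
        (_ : IsManifold (𝓡∂ 3) ∞ H₂) (_ : CompactSpace H₂) (_ : ConnectedSpace H₂)
        (b₁ : BoundaryData (𝓡∂ 3) H₁ (𝓡 2)) (b₂ : BoundaryData (𝓡∂ 3) H₂ (𝓡 2))
        (f : b₁.carrier ≃ₘ⟮𝓡 2, 𝓡 2⟯ b₂.carrier) (j₁ : H₁ → Y) (j₂ : H₂ → Y)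
        (h₁ : H₁ → X) (h₂ : H₂ → X),
        HasHandleDecomposition 2 H₁ (handleCount 1 g) ∧
        HasHandleDecomposition 2 H₂ (handleCount 1 g) ∧
        Manifold.IsSmoothEmbedding (𝓡∂ 3) (𝓡 4) ∞ h₁ ∧ range h₁ = S (i + 1) ∩ S (i + 2) ∧
          h₁ '' (𝓡∂ 3).boundary H₁ = ⋂ l, S l ∧
        Manifold.IsSmoothEmbedding (𝓡∂ 3) (𝓡 4) ∞ h₂ ∧ range h₂ = S (j + 1) ∩ S (j + 2) ∧
          h₂ '' (𝓡∂ 3).boundary H₂ = ⋂ l, S l ∧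
        IsBoundaryGluingWith b₁ b₂ f (𝓡 3) j₁ j₂ ∧ ConnectedSpace b₁.carrier ∧
        IsPathConnected (range j₁ ∩ range j₂) ∧
        ∃ (s : Y) (hs : s ∈ range j₁ ∩ range j₂)
          (ν : SurfaceGroup g ≃* FundamentalGroup ↥(range j₁ ∩ range j₂) ⟨s, hs⟩),
          groupGKTrisectionOf hS x₀ μ i =
            ((inclHomOfSubset (inter_subset_left : range j₁ ∩ range j₂ ⊆ range j₁) s hs hs.1).ker).comap
              ν.toMonoidHom ∧
          groupGKTrisectionOf hS x₀ μ j =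
            ((inclHomOfSubset (inter_subset_right : range j₁ ∩ range j₂ ⊆ range j₂) s hs hs.2).ker).comap
              ν.toMonoidHom := by
  sorry

/-- **STUB 6 — KERNEL TRANSPORT along a homeomorphism of triads (M; pure algebraic topology).**
A homeomorphism `Φ : Y ≃ₜ Y'` with `Φ(A) = A'`, `Φ(B) = B'`, `A ∩ B` path connected, and markings
`ν : Γ ≅ π₁(A ∩ B, s)`, `ν' : Γ ≅ π₁(A' ∩ B', s')` at ARBITRARY base points, yield ONE automorphism
`α` of `Γ` carrying the kernel pair `(ker π₁(A∩B) → π₁A, ker π₁(A∩B) → π₁B)` (pulled back by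
`ν`) onto the corresponding pair for `(Y'; A', B')` (pulled back by `ν'`):
`α = ν'⁻¹ ∘ (change of base point along a path from Φ s to s' inside A' ∩ B') ∘ (Φ|_{A∩B})_* ∘ ν`;
kernels of maps induced by inclusions are natural under the restricted homeomorphisms
(`exists_mulEquiv_image_comm_of_isEmbedding`-type lemmas, `InclHomTransport.lean`) and under
change of base point (`BasePointTransfer.lean`).  This is Hempel's "equivalent splitting
homomorphisms" step (proof of Thm 14.6) and the place where the SIMULTANEITY of `α` for both
kernels is manifest (cf. `Negative.PairTransferFalse.not_pairTransfer`). [cite: Hempel1976, Thm. 14.6 (proof, pp. 158–159)]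
[cite: HatcherAT2002, Prop. 1.18 and §1.1 (change of base point)] -/
theorem stub_kernelTransport :
    ∀ (Γ : Type) [Group Γ] (Y : Type) [TopologicalSpace Y] (Y' : Type) [TopologicalSpace Y']
      (A B : Set Y) (A' B' : Set Y') (Φ : Y ≃ₜ Y'),
      Φ '' A = A' → Φ '' B = B' → IsPathConnected (A ∩ B) →
    ∀ (s : Y) (hs : s ∈ A ∩ B) (s' : Y') (hs' : s' ∈ A' ∩ B')
      (ν : Γ ≃* FundamentalGroup ↥(A ∩ B) ⟨s, hs⟩)
      (ν' : Γ ≃* FundamentalGroup ↥(A' ∩ B') ⟨s', hs'⟩),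
    ∃ α : Γ ≃* Γ,
      (((inclHomOfSubset (inter_subset_left : A ∩ B ⊆ A) s hs hs.1).ker).comap
          ν.toMonoidHom).map α.toMonoidHom =
        ((inclHomOfSubset (inter_subset_left : A' ∩ B' ⊆ A') s' hs' hs'.1).ker).comap
          ν'.toMonoidHom ∧
      (((inclHomOfSubset (inter_subset_right : A ∩ B ⊆ B) s hs hs.2).ker).comap
          ν.toMonoidHom).map α.toMonoidHom =
        ((inclHomOfSubset (inter_subset_right : A' ∩ B' ⊆ B') s' hs' hs'.2).ker).comap
          ν'.toMonoidHom := by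
  sorry

/-! ## The composition (kernel-checked, no `sorry`) -/

/-- `i + 1 ≠ i + 2` in `Fin 3`. [folklore] -/
theorem fin3_succ_ne_succ_succ (i : Fin 3) : i + 1 ≠ i + 2 := by
  fin_cases i <;> decide

/-- **The composition, arrow form** (`WaldhausenPairs_from`): the six stub STATEMENTS imply the crux.
Its axiom closure is the gate whitelist only (no `sorryAx`): the reduction itself is complete.  The
conclusion is spelled `id WaldhausenPairs` for one mechanical reason: the skeleton audit takes THE
theorem concluding the crux by name to be `WaldhausenPairs_of` below (stubs fed in), and `id` keeps
this auxiliary arrow form out of that candidate scan; `id P` is definitionally `P`.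
Steps: realise `K` and `N` by STUB 1 (`N` is a group trisection of `{1}`:
`Negative.LoadBearing.stabilizeIter_isGroupTrisection`) and re-mark to equality
(`exists_marking_groupGKTrisectionOf_eq`); STUB 5 twice gives the two Heegaard realisations with
free `π₁` of rank `m+1`; the PROVED `IsGKTrisection.isOrientable_of_clause_iii` makes the four
handlebodies `IsHandlebody`, STUB 4 makes `Y`, `Y'` orientable; the PROVED composite
`heegaardSplittings_diffeomorphic_of_isFreeOfRank` (fed STUBS 3,
2 and the PROVED model `exists_oneHandlebody_mirror_four (m+1)`) gives a diffeomorphism of triples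
`(Y'; H₁', H₂') → (Y; H₁, H₂)`; STUB 6 along its underlying homeomorphism gives `α` with
`α(N_i) = K_i`, `α(N_j) = K_j`. -/
theorem WaldhausenPairs_from :
    exists_gkTrisected_of_isGroupTrisection.{0} →
    waldhausen_heegaardSplitting_sumS1S2_unique.{0} →
    diffeomorph_sumS1S2_of_isFreeOfRank_fundamentalGroup.{0} →
    -- STUB 4 (`stub_gluedOrientable`)
    (∀ (H₁ : Type) [TopologicalSpace H₁] [ChartedSpace (EuclideanHalfSpace 3) H₁]
      [IsManifold (𝓡∂ 3) ∞ H₁]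
      (H₂ : Type) [TopologicalSpace H₂] [ChartedSpace (EuclideanHalfSpace 3) H₂]
      [IsManifold (𝓡∂ 3) ∞ H₂]
      (b₁ : BoundaryData (𝓡∂ 3) H₁ (𝓡 2)) (b₂ : BoundaryData (𝓡∂ 3) H₂ (𝓡 2))
      (f : b₁.carrier ≃ₘ⟮𝓡 2, 𝓡 2⟯ b₂.carrier)
      (Y : Type) [TopologicalSpace Y] [ChartedSpace (EuclideanSpace ℝ (Fin 3)) Y]
      [IsManifold (𝓡 3) ∞ Y] (j₁ : H₁ → Y) (j₂ : H₂ → Y),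
      IsOrientable (𝓡∂ 3) H₁ → IsOrientable (𝓡∂ 3) H₂ → ConnectedSpace b₁.carrier →
      IsBoundaryGluingWith b₁ b₂ f (𝓡 3) j₁ j₂ → IsOrientable (𝓡 3) Y) →
    -- STUB 5 (`stub_pairRealization`)
    (∀ (X : Type) [TopologicalSpace X] [T2Space X] [SecondCountableTopology X]
      [ChartedSpace (EuclideanSpace ℝ (Fin 4)) X] [IsManifold (𝓡 4) ∞ X]
      (g k : ℕ) (S : Fin 3 → Set X) (hS : IsBalancedGKTrisection X g k S)
      (x₀ : centralSurface S) (μ : SurfaceGroup g ≃* FundamentalGroup (centralSurface S) x₀)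
      (i j : Fin 3), i ≠ j →
      ∃ (Y : Type) (_ : TopologicalSpace Y) (_ : T2Space Y) (_ : SecondCountableTopology Y)
        (_ : ChartedSpace (EuclideanSpace ℝ (Fin 3)) Y) (_ : IsManifold (𝓡 3) ∞ Y)
        (_ : CompactSpace Y) (_ : ConnectedSpace Y) (y : Y)
        (_ : IsFreeOfRank (FundamentalGroup Y y) k)
        (H₁ : Type) (_ : TopologicalSpace H₁) (_ : ChartedSpace (EuclideanHalfSpace 3) H₁)
        (_ : IsManifold (𝓡∂ 3) ∞ H₁) (_ : CompactSpace H₁) (_ : ConnectedSpace H₁)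
        (H₂ : Type) (_ : TopologicalSpace H₂) (_ : ChartedSpace (EuclideanHalfSpace 3) H₂)
        (_ : IsManifold (𝓡∂ 3) ∞ H₂) (_ : CompactSpace H₂) (_ : ConnectedSpace H₂)
        (b₁ : BoundaryData (𝓡∂ 3) H₁ (𝓡 2)) (b₂ : BoundaryData (𝓡∂ 3) H₂ (𝓡 2))
        (f : b₁.carrier ≃ₘ⟮𝓡 2, 𝓡 2⟯ b₂.carrier) (j₁ : H₁ → Y) (j₂ : H₂ → Y)
        (h₁ : H₁ → X) (h₂ : H₂ → X),
        HasHandleDecomposition 2 H₁ (handleCount 1 g) ∧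
        HasHandleDecomposition 2 H₂ (handleCount 1 g) ∧
        Manifold.IsSmoothEmbedding (𝓡∂ 3) (𝓡 4) ∞ h₁ ∧ range h₁ = S (i + 1) ∩ S (i + 2) ∧
          h₁ '' (𝓡∂ 3).boundary H₁ = ⋂ l, S l ∧
        Manifold.IsSmoothEmbedding (𝓡∂ 3) (𝓡 4) ∞ h₂ ∧ range h₂ = S (j + 1) ∩ S (j + 2) ∧
          h₂ '' (𝓡∂ 3).boundary H₂ = ⋂ l, S l ∧
        IsBoundaryGluingWith b₁ b₂ f (𝓡 3) j₁ j₂ ∧ ConnectedSpace b₁.carrier ∧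
        IsPathConnected (range j₁ ∩ range j₂) ∧
        ∃ (s : Y) (hs : s ∈ range j₁ ∩ range j₂)
          (ν : SurfaceGroup g ≃* FundamentalGroup ↥(range j₁ ∩ range j₂) ⟨s, hs⟩),
          groupGKTrisectionOf hS x₀ μ i =
            ((inclHomOfSubset (inter_subset_left : range j₁ ∩ range j₂ ⊆ range j₁) s hs hs.1).ker).comap
              ν.toMonoidHom ∧
          groupGKTrisectionOf hS x₀ μ j =
            ((inclHomOfSubset (inter_subset_right : range j₁ ∩ range j₂ ⊆ range j₂) s hs hs.2).ker).comap
              ν.toMonoidHom) →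
    -- STUB 6 (`stub_kernelTransport`)
    (∀ (Γ : Type) [Group Γ] (Y : Type) [TopologicalSpace Y] (Y' : Type) [TopologicalSpace Y']
      (A B : Set Y) (A' B' : Set Y') (Φ : Y ≃ₜ Y'),
      Φ '' A = A' → Φ '' B = B' → IsPathConnected (A ∩ B) →
    ∀ (s : Y) (hs : s ∈ A ∩ B) (s' : Y') (hs' : s' ∈ A' ∩ B')
      (ν : Γ ≃* FundamentalGroup ↥(A ∩ B) ⟨s, hs⟩)
      (ν' : Γ ≃* FundamentalGroup ↥(A' ∩ B') ⟨s', hs'⟩),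
    ∃ α : Γ ≃* Γ,
      (((inclHomOfSubset (inter_subset_left : A ∩ B ⊆ A) s hs hs.1).ker).comap
          ν.toMonoidHom).map α.toMonoidHom =
        ((inclHomOfSubset (inter_subset_left : A' ∩ B' ⊆ A') s' hs' hs'.1).ker).comap
          ν'.toMonoidHom ∧
      (((inclHomOfSubset (inter_subset_right : A ∩ B ⊆ B) s hs hs.2).ker).comap
          ν.toMonoidHom).map α.toMonoidHom =
        ((inclHomOfSubset (inter_subset_right : A' ∩ B' ⊆ B') s' hs' hs'.2).ker).comap
          ν'.toMonoidHom) →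
    id WaldhausenPairs := by
  intro he hW hKSP hglo hreal htr
  show WaldhausenPairs
  intro m K hK i j hij
  -- Step 1: realise `K` and `N` (AGK's `ℳ`), re-marked to equality.
  obtain ⟨X, _, _, _, _, _, _, _, o, S, hS, x₀, μ, hiso⟩ := he (3 + 3 * m) (m + 1) PUnit K hK
  obtain ⟨μK, hμK⟩ := exists_marking_groupGKTrisectionOf_eq hS x₀ μ hiso
  have hN : IsGroupTrisection (3 + 3 * m) (m + 1) (PUnit : Type) (s4Kernels.stabilizeIter m) :=
    Summit.SmoothPoincare4.SmoothPoincare4.Theorems.WaldhausenPairs.Negative.stabilizeIter_isGroupTrisection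
      m
  obtain ⟨X', _, _, _, _, _, _, _, o', S', hS', x₀', μ', hiso'⟩ :=
    he (3 + 3 * m) (m + 1) PUnit (s4Kernels.stabilizeIter m) hN
  obtain ⟨μN, hμN⟩ := exists_marking_groupGKTrisectionOf_eq hS' x₀' μ' hiso'
  -- Step 2: both pairs as Heegaard pairs of closed 3-manifolds with free `π₁` of rank `m+1`.
  obtain ⟨Y, _, _, _, _, _, _, _, y, hYf, H₁, _, _, _, _, _, H₂, _, _, _, _, _, b₁, b₂, f, j₁, j₂,
      h₁, h₂, hhd₁, hhd₂, hh₁, hr₁, hb₁, hh₂, hr₂, hb₂, hglue, hconn, hpc, s, hs, ν, hKi, hKj⟩ :=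
    hreal X (3 + 3 * m) (m + 1) S hS x₀ μK i j hij
  obtain ⟨Y', _, _, _, _, _, _, _, y', hYf', H₁', _, _, _, _, _, H₂', _, _, _, _, _, b₁', b₂', f',
      j₁', j₂', h₁', h₂', hhd₁', hhd₂', hh₁', hr₁', hb₁', hh₂', hr₂', hb₂', hglue', hconn', hpc',
      s', hs', ν', hNi, hNj⟩ :=
    hreal X' (3 + 3 * m) (m + 1) S' hS' x₀' μN i j hij
  -- Step 3: the handlebodies are orientable (PROVED in the tree:
  -- `IsGKTrisection.isOrientable_of_clause_iii`), hence `IsHandlebody`; `Y`, `Y'` orientable (STUB 4).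
  have hoH₁ : IsOrientable (𝓡∂ 3) H₁ :=
    hS.isGKTrisection.isOrientable_of_clause_iii ⟨o⟩ (fin3_succ_ne_succ_succ i) h₁ hh₁ hr₁ hb₁
  have hoH₂ : IsOrientable (𝓡∂ 3) H₂ :=
    hS.isGKTrisection.isOrientable_of_clause_iii ⟨o⟩ (fin3_succ_ne_succ_succ j) h₂ hh₂ hr₂ hb₂
  have hoH₁' : IsOrientable (𝓡∂ 3) H₁' :=
    hS'.isGKTrisection.isOrientable_of_clause_iii ⟨o'⟩ (fin3_succ_ne_succ_succ i) h₁' hh₁' hr₁' hb₁'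
  have hoH₂' : IsOrientable (𝓡∂ 3) H₂' :=
    hS'.isGKTrisection.isOrientable_of_clause_iii ⟨o'⟩ (fin3_succ_ne_succ_succ j) h₂' hh₂' hr₂' hb₂'
  have hH₁ : IsHandlebody (3 + 3 * m) H₁ := ⟨‹_›, ‹_›, hoH₁, hhd₁⟩
  have hH₂ : IsHandlebody (3 + 3 * m) H₂ := ⟨‹_›, ‹_›, hoH₂, hhd₂⟩
  have hH₁' : IsHandlebody (3 + 3 * m) H₁' := ⟨‹_›, ‹_›, hoH₁', hhd₁'⟩
  have hH₂' : IsHandlebody (3 + 3 * m) H₂' := ⟨‹_›, ‹_›, hoH₂', hhd₂'⟩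
  have hYo : IsOrientable (𝓡 3) Y := hglo H₁ H₂ b₁ b₂ f Y j₁ j₂ hoH₁ hoH₂ hconn hglue
  have hYo' : IsOrientable (𝓡 3) Y' := hglo H₁' H₂' b₁' b₂' f' Y' j₁' j₂' hoH₁' hoH₂' hconn' hglue'
  -- Step 4: one model 1-handlebody `V` (proved), KSP + Waldhausen (facts) through the proved composite.
  obtain ⟨V, _, _, _, _, _, _, _, bV, ρ₀, hVh, hVo, -, -, -⟩ := exists_oneHandlebody_mirror_four (m + 1)
  obtain ⟨Φ, ψ₁, ψ₂, hΦ₁, hΦ₂⟩ :=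
    heegaardSplittings_diffeomorphic_of_isFreeOfRank hKSP hW (m + 1) V hVh hVo bV
      Y' hYo' y' hYf' Y hYo y hYf (3 + 3 * m)
      H₁' H₂' b₁' b₂' f' j₁' j₂' hH₁' hH₂' hglue' H₁ H₂ b₁ b₂ f j₁ j₂ hH₁ hH₂ hglue
  -- Step 5: transport the kernel pair along the homeomorphism of triads (STUB 6).
  have hA : (Φ.toHomeomorph : Y' → Y) '' range j₁' = range j₁ := by
    rw [Diffeomorph.coe_toHomeomorph, ← range_comp, hΦ₁, range_comp, EquivLike.range_eq_univ,
      image_univ]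
  have hB : (Φ.toHomeomorph : Y' → Y) '' range j₂' = range j₂ := by
    rw [Diffeomorph.coe_toHomeomorph, ← range_comp, hΦ₂, range_comp, EquivLike.range_eq_univ,
      image_univ]
  obtain ⟨α, hα₁, hα₂⟩ := htr (SurfaceGroup (3 + 3 * m)) Y' Y (range j₁') (range j₂') (range j₁)
    (range j₂) Φ.toHomeomorph hA hB hpc' s' hs' s hs ν' ν
  refine ⟨α, ?_, ?_⟩
  · rw [((congrFun hμN i).symm.trans hNi), ((congrFun hμK i).symm.trans hKi)]
    exact hα₁
  · rw [((congrFun hμN j).symm.trans hNj), ((congrFun hμK j).symm.trans hKj)]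
    exact hα₂

/-- **`WaldhausenPairs_of` — the skeleton theorem: the crux BY NAME from the six registered
stubs** (the arrow form `WaldhausenPairs_from` fed `stub_*`; this also checks that the stub
statements are literally its hypotheses; `sorry` occurs only inside `stub_*`). -/
theorem WaldhausenPairs_of : WaldhausenPairs :=
  WaldhausenPairs_from stub_agkRealization stub_waldhausen stub_freePiOneRecognition
    stub_gluedOrientable stub_pairRealization stub_kernelTransport

end Summit.SmoothPoincare4.SmoothPoincare4.Cruxes.WaldhausenPairs.AgkRealizationDevice

end
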